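import Summits.HodgeConjecture.CorCM.Census.OcticTwistLawAll

/-!
# The octic twist `(ℤ/8 × B, (4,0))`, XXIV: THE SCREW COLUMN (a) — reduced affine forms, the residual junk calculus and the shift identity
# in the second coordinate

COR-CM (cell `pub-hodgecm2`), count-neutral kernel combinatorics by the binder seat b09 (gen 35; lane COINVARIANT-TWIST / OCTIC RECON, the
screw column of `HOME/pub-hodgecm2-b09/lean-g34/OCTIC-LAW.md`; design note `HOME/pub-hodgecm2-b09/lean-g35/SCREW.md`), on top of parts
I–XX (`Census/OcticTwist*.lean`: `tens`, `pairVec₂`, `pairs₂`, `Xvec`/`Wvec` lifts, `Wvec_eq_sum`, `tens_sum_left`, `tens_sub_sub`) and the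
quartic clock model (`QuarticTwistModel`: `cst`, `atom`, `tw`, `transl`; `QuarticTwistReduction`: `atomVec`, `affine`, `affine_square`;
`QuarticTwistResidual`: `Xvec`, `Wvec`) BY NAME.  Four bookkeeping definitions with bodies (`ratomVec`, `raffine`, and the two generator
sets `atomDiffs`, `resDiffs` of the junk calculus) + theorems; no `Prop`-valued definition, no certificate, no named fact, no `sorry`.
HONEST FRAMING: `HC_CM` is NOT proved, here or anywhere in the tree; nothing here is a period or a headline.

WHY (the screw column).  Part XXIII proved `μ_hodge(ℤ/8 × B, (4,0)) = β − 1` for every finite `B` (`|B| ≥ 3`) WITHOUT elements of order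
divisible by `8`; part XXI the sandwich `β − 2 ≤ μ ≤ β − 1` for all `B`.  When `B` has an element `τ` with `8 ∣ ord τ` there is a SCREW PAIR
TYPE `T₀ = (ψ, (0,τ)·ψ)` fixed by the odd motion `act true (0,τ)` (`ψ` a quartic screw type for `2τ`), and the saving of one closing face comes
from reducing `e_{T₀}` to a product of affine forms in two ways (parts XXV–XXVI).  The product reduction runs through `2`-atoms in the passive
coordinate, which the plain affine form `A_u(s)` does not see; hence the REDUCED affine form of this file.

WHAT.
* §1 `ratomVec u s b` — the atom of `s` at `b` seen from `u`, with the `2`-atom `u + 2δ_b` replaced by its column-face reduction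
  `e_{u+δ_b} + e_{u−δ_b} − e_u`; `raffine u s = Σ_b ratomVec u s b − (|B| − 1) e_u` — additive over cross squares (`raffine_square`), equal to
  `e_s` on small residual types (`raffine_atom`), the column-face reduction on `2`-atoms (`raffine_two_atom`), and translation-covariant
  (`transl_raffine`).
* §2 THE JUNK CALCULUS.  If `N₂` contains the mixed squares `(e_a − e_u) ⊗ (e_{a′} − e_{u′})` and the D-moves of both kinds, then
  `P ⊗ Q ∈ N₂` and `Q ⊗ P ∈ N₂` whenever `Q` is in the span of the atom differences `e_{u ± δ_b} − e_u` and `P` in the span of the atom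
  differences and the constant differences `e_u − e_{u′}` (`tens_mem_of_mem_spanL_spanA`, `tens_mem_of_mem_spanA_spanL`); and
  `raffine u s − e_u` lies in the atom-difference span, `raffine u s − raffine u′ s′` in the larger span.
* §3 THE SHIFT IDENTITY IN THE SECOND COORDINATE (`cst_tens_shift_mem`): modulo the octic pairs, the lifts `e_y ⊗ X_{u,b}` and the D-moves
  `(e_y − e_{y′}) ⊗ (e_a − e_u)`, `e_{cst y} ⊗ (raffine (v+1) t − raffine v t) ≡ e_{cst y} ⊗ w_{v+1}` for EVERY type `t` — the quartic shift
  identity of `Census/QuarticTwistScrew.lean` (`affine_succ_sub_affine_mem`), reduced and tensored with a constant, column by column.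
All [folklore].

## References
* [Pohlmann1968] H. Pohlmann, Algebraic cycles on abelian varieties of complex multiplication type, Ann. of Math. 88 (1968), Thm 1.
-/

namespace Summit.HodgeConjecture.CorCM.Census.OcticTwist

open Finset
open Summit.HodgeConjecture.CorCM.Census.QuarticTwist

variable (B : Type) [AddGroup B] [Fintype B] [DecidableEq B]

/-! ## §1 The reduced affine form -/

/-- **The reduced atom vector** of `s` at the column `b` seen from `u`: `e_{u + (s b − u)δ_b}`, except that the `2`-atom `u + 2δ_b` is replaced by
its column-face reduction `e_{u+δ_b} + e_{u−δ_b} − e_u`. [folklore] -/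
def ratomVec (u : ZMod 4) (s : Ty B) (b : B) : Ty B → ℤ :=
  if s b - u = 2 then Pi.single (atom B u b 1) 1 + Pi.single (atom B u b (-1)) 1 - Pi.single (cst B u) 1
  else Pi.single (atom B u b (s b - u)) 1

/-- **The reduced affine form** of `s` seen from `u`: `Σ_b ratomVec u s b − (|B| − 1)·e_u` (supported on the constant type `u` and the
`±1`-atoms `u ± δ_b`). [folklore] -/
def raffine (u : ZMod 4) (s : Ty B) : Ty B → ℤ :=
  ∑ b, ratomVec B u s b - ((Fintype.card B : ℤ) - 1) • Pi.single (cst B u) 1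

omit [AddGroup B] in
/-- The reduced atom vector at `b` depends only on `s b`. [folklore] -/
theorem ratomVec_congr (u : ZMod 4) {s s' : Ty B} {b : B} (h : s b = s' b) : ratomVec B u s b = ratomVec B u s' b := by
  unfold ratomVec; rw [h]

omit [AddGroup B] in
/-- **Additivity of the reduced affine form over a cross square** (columns `b₁ ≠ b₂`, any values). [folklore] -/
theorem raffine_square (u : ZMod 4) (s : Ty B) {b₁ b₂ : B} (hb : b₁ ≠ b₂) (k₁ k₂ : ZMod 4) :
    raffine B u s - raffine B u (s + Pi.single b₁ k₁) - raffine B u (s + Pi.single b₂ k₂)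
      + raffine B u (s + Pi.single b₁ k₁ + Pi.single b₂ k₂) = 0 := by
  unfold raffine
  have hsum : ∑ b, ratomVec B u s b - ∑ b, ratomVec B u (s + Pi.single b₁ k₁) b - ∑ b, ratomVec B u (s + Pi.single b₂ k₂) b
      + ∑ b, ratomVec B u (s + Pi.single b₁ k₁ + Pi.single b₂ k₂) b = 0 := by
    rw [← Finset.sum_sub_distrib, ← Finset.sum_sub_distrib, ← Finset.sum_add_distrib]
    refine Finset.sum_eq_zero ?_
    intro b _
    by_cases h1 : b = b₁
    · subst h1
      have e2 : (s + Pi.single b₂ k₂ : Ty B) b = s b := by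
        rw [Pi.add_apply, Pi.single_eq_of_ne hb, add_zero]
      have e12 : (s + Pi.single b k₁ + Pi.single b₂ k₂ : Ty B) b = (s + Pi.single b k₁ : Ty B) b := by
        rw [Pi.add_apply, Pi.single_eq_of_ne hb, add_zero]
      rw [ratomVec_congr B u e2, ratomVec_congr B u e12]; abel
    · have e1 : (s + Pi.single b₁ k₁ : Ty B) b = s b := by
        rw [Pi.add_apply, Pi.single_eq_of_ne h1, add_zero]
      have e12 : (s + Pi.single b₁ k₁ + Pi.single b₂ k₂ : Ty B) b = (s + Pi.single b₂ k₂ : Ty B) b := by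
        simp only [Pi.add_apply, Pi.single_eq_of_ne h1, add_zero]
      rw [ratomVec_congr B u e1, ratomVec_congr B u e12]; abel
  have e : ∀ A1 A2 A3 A4 C : Ty B → ℤ, A1 - C - (A2 - C) - (A3 - C) + (A4 - C) = A1 - A2 - A3 + A4 := fun _ _ _ _ _ => by abel
  rw [e, hsum]

omit [AddGroup B] in
/-- Off the column of an atom the reduced atom vector is the constant. [folklore] -/
theorem ratomVec_atom_of_ne (u : ZMod 4) (b : B) (k : ZMod 4) {x : B} (hx : x ≠ b) :
    ratomVec B u (atom B u b k) x = Pi.single (cst B u) 1 := by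
  unfold ratomVec
  rw [atom_apply, if_neg hx, sub_self, if_neg (by decide), atom_zero]

omit [AddGroup B] in
/-- The sum of the reduced atom vectors of an atom: its own column plus `|B| − 1` constants. [folklore] -/
theorem sum_ratomVec_atom (u : ZMod 4) (b : B) (k : ZMod 4) :
    ∑ x, ratomVec B u (atom B u b k) x = ratomVec B u (atom B u b k) b + ((Fintype.card B : ℤ) - 1) • Pi.single (cst B u) 1 := by
  rw [← Finset.add_sum_erase _ _ (mem_univ b)]
  congr 1
  have hx : ∀ x ∈ univ.erase b, ratomVec B u (atom B u b k) x = Pi.single (cst B u) 1 :=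
    fun x hx => ratomVec_atom_of_ne B u b k (ne_of_mem_erase hx)
  rw [Finset.sum_congr rfl hx, Finset.sum_const, Finset.card_erase_of_mem (mem_univ b), Finset.card_univ]
  have h1 : 1 ≤ Fintype.card B := Fintype.card_pos_iff.mpr ⟨b⟩
  rw [← natCast_zsmul]
  congr 1
  omega

omit [AddGroup B] in
/-- **On a small residual type the reduced affine form is the unit vector**: `raffine u (u + kδ_b) = e_{u+kδ_b}` for `k ∈ {0, 1, −1}`. [folklore] -/
theorem raffine_atom (u : ZMod 4) (b : B) {k : ZMod 4} (hk : k = 0 ∨ k = 1 ∨ k = -1) :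
    raffine B u (atom B u b k) = Pi.single (atom B u b k) 1 := by
  unfold raffine
  rw [sum_ratomVec_atom, add_sub_cancel_right]
  unfold ratomVec
  rw [atom_apply, if_pos rfl, add_sub_cancel_left]
  have hk2 : k ≠ 2 := by rcases hk with rfl | rfl | rfl <;> decide
  rw [if_neg hk2]

omit [AddGroup B] in
/-- **On a constant type the reduced affine form is the unit vector.** [folklore] -/
theorem raffine_cst (u : ZMod 4) (b : B) : raffine B u (cst B u) = Pi.single (cst B u) 1 := by
  rw [← atom_zero B u b, raffine_atom B u b (Or.inl rfl)]

omit [AddGroup B] in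
/-- **On a `2`-atom the reduced affine form is the column-face reduction** `e_{u+δ_b} + e_{u−δ_b} − e_u`. [folklore] -/
theorem raffine_two_atom (u : ZMod 4) (b : B) :
    raffine B u (atom B u b 2) = Pi.single (atom B u b 1) 1 + Pi.single (atom B u b (-1)) 1 - Pi.single (cst B u) 1 := by
  unfold raffine
  rw [sum_ratomVec_atom, add_sub_cancel_right]
  unfold ratomVec
  rw [atom_apply, if_pos rfl, add_sub_cancel_left, if_pos rfl]

/-- **Translates of reduced affine forms**: `(g₁,g₂)·raffine u s = raffine (u + g₁) ((g₁,g₂)·s)`. [folklore] -/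
theorem transl_raffine (g : ZMod 4 × B) (u : ZMod 4) (s : Ty B) :
    transl B g (raffine B u s) = raffine B (u + g.1) (tw B g s) := by
  unfold raffine
  rw [transl_sub, transl_smul, transl_sum, transl_single, tw_cst]
  congr 1
  have hb : ∀ b : B, transl B g (ratomVec B u s b) = ratomVec B (u + g.1) (tw B g s) (b - g.2) := by
    intro b
    have e : tw B g s (b - g.2) - (u + g.1) = s b - u := by
      show s (b - g.2 + g.2) + g.1 - (u + g.1) = s b - u
      rw [sub_add_cancel]; ring
    unfold ratomVec
    rw [e]
    split_ifs
    · rw [transl_sub, transl_add, transl_single, transl_single, transl_single, tw_atom, tw_atom, tw_cst]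
    · rw [transl_single, tw_atom]
  rw [Finset.sum_congr rfl fun b _ => hb b]
  exact Fintype.sum_equiv (Equiv.subRight g.2) _ _ fun b => rfl

/-! ## §2 The junk calculus: atom differences against atom and constant differences -/

omit [AddGroup B] [DecidableEq B] [Fintype B] in
/-- `tens` is additive over finite sums in the second factor. [folklore] -/
theorem tens_sum_right {ι : Type} (S : Finset ι) (v : Ty B → ℤ) (f : ι → Ty B → ℤ) :
    tens B v (∑ i ∈ S, f i) = ∑ i ∈ S, tens B v (f i) := by
  funext T
  rw [Finset.sum_apply]
  show v T.1 * (∑ i ∈ S, f i) T.2 = ∑ i ∈ S, v T.1 * f i T.2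
  rw [Finset.sum_apply, Finset.mul_sum]

/-- The set of ATOM DIFFERENCES `e_{u+kδ_b} − e_u`, `k = ±1`. [folklore] -/
def atomDiffs : Set (Ty B → ℤ) :=
  {v | ∃ (u : ZMod 4) (b : B) (k : ZMod 4), (k = 1 ∨ k = -1) ∧ v = Pi.single (atom B u b k) 1 - Pi.single (cst B u) 1}

/-- The set of atom differences and CONSTANT DIFFERENCES `e_u − e_{u′}`. [folklore] -/
def resDiffs : Set (Ty B → ℤ) :=
  atomDiffs B ∪ {v | ∃ u u' : ZMod 4, v = Pi.single (cst B u) 1 - Pi.single (cst B u') 1}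

omit [AddGroup B] [Fintype B] [DecidableEq B] in
/-- The linear map `P ↦ P ⊗ Q`. [folklore] -/
theorem tens_left_linear (Q : Ty B → ℤ) :
    ∃ f : (Ty B → ℤ) →ₗ[ℤ] (Ty₂ B → ℤ), ∀ P, f P = tens B P Q :=
  ⟨{ toFun := fun P => tens B P Q, map_add' := fun P P' => tens_add_left B P P' Q, map_smul' := fun c P => tens_smul_left B c P Q },
    fun _ => rfl⟩

omit [AddGroup B] [Fintype B] [DecidableEq B] in
/-- The linear map `Q ↦ P ⊗ Q`. [folklore] -/
theorem tens_right_linear (P : Ty B → ℤ) :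
    ∃ f : (Ty B → ℤ) →ₗ[ℤ] (Ty₂ B → ℤ), ∀ Q, f Q = tens B P Q :=
  ⟨{ toFun := fun Q => tens B P Q, map_add' := fun Q Q' => tens_add_right B P Q Q', map_smul' := fun c Q => tens_smul_right B c P Q },
    fun _ => rfl⟩

omit [AddGroup B] [Fintype B] [DecidableEq B] in
/-- If `P ⊗ q ∈ N₂` for every `q` in a set, then `P ⊗ Q ∈ N₂` for every `Q` in its span. [folklore] -/
theorem tens_mem_of_mem_span_right {N₂ : Submodule ℤ (Ty₂ B → ℤ)} (P : Ty B → ℤ) {S : Set (Ty B → ℤ)}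
    (h : ∀ q ∈ S, tens B P q ∈ N₂) {Q : Ty B → ℤ} (hQ : Q ∈ Submodule.span ℤ S) : tens B P Q ∈ N₂ := by
  obtain ⟨f, hf⟩ := tens_right_linear B P
  have hle : Submodule.span ℤ S ≤ N₂.comap f := Submodule.span_le.mpr fun q hq => by
    show f q ∈ N₂
    rw [hf]; exact h q hq
  have := hle hQ
  rw [Submodule.mem_comap, hf] at this
  exact this

omit [AddGroup B] [Fintype B] [DecidableEq B] in
/-- If `p ⊗ Q ∈ N₂` for every `p` in a set, then `P ⊗ Q ∈ N₂` for every `P` in its span. [folklore] -/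
theorem tens_mem_of_mem_span_left {N₂ : Submodule ℤ (Ty₂ B → ℤ)} (Q : Ty B → ℤ) {S : Set (Ty B → ℤ)}
    (h : ∀ p ∈ S, tens B p Q ∈ N₂) {P : Ty B → ℤ} (hP : P ∈ Submodule.span ℤ S) : tens B P Q ∈ N₂ := by
  obtain ⟨f, hf⟩ := tens_left_linear B Q
  have hle : Submodule.span ℤ S ≤ N₂.comap f := Submodule.span_le.mpr fun p hp => by
    show f p ∈ N₂
    rw [hf]; exact h p hp
  have := hle hP
  rw [Submodule.mem_comap, hf] at this
  exact this

omit [AddGroup B] in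
/-- **Junk (i)**: `P ⊗ Q ∈ N₂` for `P` in the span of the atom and constant differences and `Q` in the span of the atom differences, as soon
as `N₂` contains the mixed squares and the D-moves `(e_{u′} − e_{u″}) ⊗ (e_a − e_u)`. [folklore] -/
theorem tens_mem_of_mem_spanL_spanA {N₂ : Submodule ℤ (Ty₂ B → ℤ)}
    (hsq : ∀ (u : ZMod 4) (b : B) (k : ZMod 4) (u' : ZMod 4) (b' : B) (k' : ZMod 4), (k = 1 ∨ k = -1) → (k' = 1 ∨ k' = -1) →
      tens B (Pi.single (atom B u b k) 1 - Pi.single (cst B u) 1) (Pi.single (atom B u' b' k') 1 - Pi.single (cst B u') 1) ∈ N₂)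
    (hD1 : ∀ (u : ZMod 4) (b : B) (k : ZMod 4) (u' u'' : ZMod 4), (k = 1 ∨ k = -1) →
      tens B (Pi.single (cst B u') 1 - Pi.single (cst B u'') 1) (Pi.single (atom B u b k) 1 - Pi.single (cst B u) 1) ∈ N₂)
    {P Q : Ty B → ℤ} (hP : P ∈ Submodule.span ℤ (resDiffs B)) (hQ : Q ∈ Submodule.span ℤ (atomDiffs B)) : tens B P Q ∈ N₂ := by
  refine tens_mem_of_mem_span_right B P (fun q hq => ?_) hQ
  obtain ⟨u, b, k, hk, rfl⟩ := hq
  refine tens_mem_of_mem_span_left B _ (fun p hp => ?_) hP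
  rcases hp with ⟨u', b', k', hk', rfl⟩ | ⟨u', u'', rfl⟩
  · exact hsq u' b' k' u b k hk' hk
  · exact hD1 u b k u' u'' hk

omit [AddGroup B] in
/-- **Junk (ii)**: `Q ⊗ P ∈ N₂` for `Q` in the span of the atom differences and `P` in the span of the atom and constant differences, as soon
as `N₂` contains the mixed squares and the D-moves `(e_a − e_u) ⊗ (e_{u′} − e_{u″})`. [folklore] -/
theorem tens_mem_of_mem_spanA_spanL {N₂ : Submodule ℤ (Ty₂ B → ℤ)}
    (hsq : ∀ (u : ZMod 4) (b : B) (k : ZMod 4) (u' : ZMod 4) (b' : B) (k' : ZMod 4), (k = 1 ∨ k = -1) → (k' = 1 ∨ k' = -1) →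
      tens B (Pi.single (atom B u b k) 1 - Pi.single (cst B u) 1) (Pi.single (atom B u' b' k') 1 - Pi.single (cst B u') 1) ∈ N₂)
    (hD0 : ∀ (u : ZMod 4) (b : B) (k : ZMod 4) (u' u'' : ZMod 4), (k = 1 ∨ k = -1) →
      tens B (Pi.single (atom B u b k) 1 - Pi.single (cst B u) 1) (Pi.single (cst B u') 1 - Pi.single (cst B u'') 1) ∈ N₂)
    {Q P : Ty B → ℤ} (hQ : Q ∈ Submodule.span ℤ (atomDiffs B)) (hP : P ∈ Submodule.span ℤ (resDiffs B)) : tens B Q P ∈ N₂ := by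
  refine tens_mem_of_mem_span_left B P (fun q hq => ?_) hQ
  obtain ⟨u, b, k, hk, rfl⟩ := hq
  refine tens_mem_of_mem_span_right B _ (fun p hp => ?_) hP
  rcases hp with ⟨u', b', k', hk', rfl⟩ | ⟨u', u'', rfl⟩
  · exact hsq u b k u' b' k' hk hk'
  · exact hD0 u b k u' u'' hk

omit [AddGroup B] in
/-- Each reduced atom vector minus the constant is in the span of the atom differences. [folklore] -/
theorem ratomVec_sub_cst_mem (u : ZMod 4) (s : Ty B) (b : B) :
    ratomVec B u s b - Pi.single (cst B u) 1 ∈ Submodule.span ℤ (atomDiffs B) := by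
  unfold ratomVec
  split_ifs with h
  · have e : (Pi.single (atom B u b 1) (1 : ℤ) + Pi.single (atom B u b (-1)) 1 - Pi.single (cst B u) 1 - Pi.single (cst B u) 1 : Ty B → ℤ)
        = (Pi.single (atom B u b 1) 1 - Pi.single (cst B u) 1) + (Pi.single (atom B u b (-1)) 1 - Pi.single (cst B u) 1) := by abel
    rw [e]
    exact Submodule.add_mem _ (Submodule.subset_span ⟨u, b, 1, Or.inl rfl, rfl⟩) (Submodule.subset_span ⟨u, b, -1, Or.inr rfl, rfl⟩)
  · have key : ∀ z : ZMod 4, z ≠ 2 → z = 0 ∨ (z = 1 ∨ z = -1) := by decide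
    rcases key (s b - u) h with h0 | h1
    · rw [h0, atom_zero, sub_self]
      exact Submodule.zero_mem _
    · exact Submodule.subset_span ⟨u, b, s b - u, h1, rfl⟩

omit [AddGroup B] in
/-- **`raffine u s − e_u` lies in the span of the atom differences.** [folklore] -/
theorem raffine_sub_cst_mem (u : ZMod 4) (s : Ty B) :
    raffine B u s - Pi.single (cst B u) 1 ∈ Submodule.span ℤ (atomDiffs B) := by
  have e : raffine B u s - Pi.single (cst B u) 1 = ∑ b, (ratomVec B u s b - Pi.single (cst B u) 1) := by
    unfold raffine
    rw [Finset.sum_sub_distrib, Finset.sum_const, Finset.card_univ, ← natCast_zsmul]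
    have e1 : ∀ (A C : Ty B → ℤ) (n : ℤ), A - (n - 1) • C - C = A - n • C := fun A C n => by
      rw [sub_smul, one_smul]; abel
    rw [e1]
  rw [e]
  exact Submodule.sum_mem _ fun b _ => ratomVec_sub_cst_mem B u s b

omit [AddGroup B] in
/-- The atom-difference span is contained in the span of the atom and constant differences. [folklore] -/
theorem span_atomDiffs_le : Submodule.span ℤ (atomDiffs B) ≤ Submodule.span ℤ (resDiffs B) :=
  Submodule.span_mono Set.subset_union_left

omit [AddGroup B] in
/-- **A difference of reduced affine forms lies in the span of the atom and constant differences.** [folklore] -/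
theorem raffine_sub_raffine_mem (u u' : ZMod 4) (s s' : Ty B) :
    raffine B u s - raffine B u' s' ∈ Submodule.span ℤ (resDiffs B) := by
  have e : raffine B u s - raffine B u' s' = (raffine B u s - Pi.single (cst B u) 1) - (raffine B u' s' - Pi.single (cst B u') 1)
      + (Pi.single (cst B u) 1 - Pi.single (cst B u') 1) := by abel
  rw [e]
  exact Submodule.add_mem _ (Submodule.sub_mem _ (span_atomDiffs_le B (raffine_sub_cst_mem B u s))
    (span_atomDiffs_le B (raffine_sub_cst_mem B u' s'))) (Submodule.subset_span (Or.inr ⟨u, u', rfl⟩))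

/-! ## §3 The shift identity in the second coordinate -/

omit [AddGroup B] in
/-- The reduced shift difference minus the Weil vector, column by column:
`raffine (v+1) t − raffine v t − w_{v+1} = Σ_b (ratomVec (v+1) t b − ratomVec v t b − e_{(v+1)−δ_b} + e_v)`. [folklore] -/
theorem raffine_succ_sub_eq_sum (v : ZMod 4) (t : Ty B) :
    raffine B (v + 1) t - raffine B v t - Wvec B (v + 1) =
      ∑ b, (ratomVec B (v + 1) t b - ratomVec B v t b - Pi.single (atom B (v + 1) b (-1)) 1 + Pi.single (cst B v) 1) := by
  funext s
  unfold raffine Wvec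
  simp only [Finset.sum_apply, Pi.add_apply, Pi.sub_apply, Pi.smul_apply, smul_eq_mul, Finset.sum_sub_distrib, Finset.sum_add_distrib,
    Finset.sum_const, Finset.card_univ, nsmul_eq_mul, add_sub_cancel_right]
  ring

omit [AddGroup B] in
/-- The pair-and-D-move bracket: `e_{cst y} ⊗ ((e_{v−δ_b} − e_v) + (e_{(v+2)−δ_b} − e_{v+2}))` lies in `N₂` (two octic pairs and one D-move).
[folklore] -/
theorem cst_tens_bracket_mem {N₂ : Submodule ℤ (Ty₂ B → ℤ)} (hP : pairs₂ B ≤ N₂)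
    (hD1 : ∀ (u : ZMod 4) (b : B) (k : ZMod 4) (u' u'' : ZMod 4), (k = 1 ∨ k = -1) →
      tens B (Pi.single (cst B u') 1 - Pi.single (cst B u'') 1) (Pi.single (atom B u b k) 1 - Pi.single (cst B u) 1) ∈ N₂)
    (y v : ZMod 4) (b : B) :
    tens B (Pi.single (cst B y) 1) ((Pi.single (atom B v b (-1)) 1 - Pi.single (cst B v) 1)
      + (Pi.single (atom B (v + 2) b (-1)) 1 - Pi.single (cst B (v + 2)) 1)) ∈ N₂ := by
  have e : tens B (Pi.single (cst B y) 1) ((Pi.single (atom B v b (-1)) 1 - Pi.single (cst B v) 1)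
      + (Pi.single (atom B (v + 2) b (-1)) 1 - Pi.single (cst B (v + 2)) 1))
      = (pairVec₂ B (cst B y, atom B v b (-1)) - pairVec₂ B (cst B y, cst B v))
        + tens B (Pi.single (cst B y) 1 - Pi.single (cst B (y + 2)) 1) (Pi.single (atom B (v + 2) b (-1)) 1 - Pi.single (cst B (v + 2)) 1) := by
    unfold pairVec₂
    simp only [cst_add_two, atom_add_two]
    rw [single_eq_tens B (cst B y) (atom B v b (-1)), single_eq_tens B (cst B (y + 2)) (atom B (v + 2) b (-1)),
      single_eq_tens B (cst B y) (cst B v), single_eq_tens B (cst B (y + 2)) (cst B (v + 2)), tens_add_right, tens_sub_right,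
      tens_sub_right, tens_sub_sub]
    abel
  rw [e]
  exact Submodule.add_mem _ (Submodule.sub_mem _ (hP (pairVec₂_mem_pairs₂ B _)) (hP (pairVec₂_mem_pairs₂ B _)))
    (hD1 (v + 2) b (-1) y (y + 2) (Or.inr rfl))

omit [AddGroup B] in
/-- **The shift identity, one column**: `e_{cst y} ⊗ (ratomVec (v+1) t b − ratomVec v t b − e_{(v+1)−δ_b} + e_v) ∈ N₂`. [folklore] -/
theorem cst_tens_shift_column_mem {N₂ : Submodule ℤ (Ty₂ B → ℤ)} (hP : pairs₂ B ≤ N₂)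
    (hX1 : ∀ (u : ZMod 4) (b : B) (u' : ZMod 4), tens B (Pi.single (cst B u') 1) (Xvec B u b) ∈ N₂)
    (hD1 : ∀ (u : ZMod 4) (b : B) (k : ZMod 4) (u' u'' : ZMod 4), (k = 1 ∨ k = -1) →
      tens B (Pi.single (cst B u') 1 - Pi.single (cst B u'') 1) (Pi.single (atom B u b k) 1 - Pi.single (cst B u) 1) ∈ N₂)
    (y v : ZMod 4) (t : Ty B) (b : B) :
    tens B (Pi.single (cst B y) 1)
      (ratomVec B (v + 1) t b - ratomVec B v t b - Pi.single (atom B (v + 1) b (-1)) 1 + Pi.single (cst B v) 1) ∈ N₂ := by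
  have hbr := cst_tens_bracket_mem B hP hD1 y v b
  have hX := hX1 v b y
  have hX' := hX1 (v + 1) b y
  have key : ∀ z : ZMod 4, z = 0 ∨ z = 1 ∨ z = 2 ∨ z = 3 := by decide
  have e1 : t b - (v + 1) = t b - v - 1 := by ring
  unfold ratomVec
  rw [e1]
  rcases key (t b - v) with hz | hz | hz | hz <;> rw [hz]
  · -- `t b = v`: the column contributes nothing
    rw [if_neg (by decide), if_neg (by decide), show (0 : ZMod 4) - 1 = -1 by decide, atom_zero]
    have e : (Pi.single (atom B (v + 1) b (-1)) (1 : ℤ) - Pi.single (cst B v) 1 - Pi.single (atom B (v + 1) b (-1)) 1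
        + Pi.single (cst B v) 1 : Ty B → ℤ) = 0 := by abel
    rw [e, tens_zero_right]
    exact Submodule.zero_mem _
  · -- `t b = v + 1`: `−X_{v,b}`
    rw [if_neg (by decide), if_neg (by decide), show (1 : ZMod 4) - 1 = 0 by decide, atom_zero]
    have e : (Pi.single (cst B (v + 1)) (1 : ℤ) - Pi.single (atom B v b 1) 1 - Pi.single (atom B (v + 1) b (-1)) 1
        + Pi.single (cst B v) 1 : Ty B → ℤ) = -Xvec B v b := by
      unfold Xvec; abel
    rw [e, ← neg_one_smul ℤ, tens_smul_right]
    exact Submodule.smul_mem _ _ hX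
  · -- `t b = v + 2`: `X_{v+1,b} − X_{v,b} − bracket`
    rw [if_neg (by decide), if_pos rfl, show (2 : ZMod 4) - 1 = 1 by decide]
    have e : (Pi.single (atom B (v + 1) b 1) (1 : ℤ) - (Pi.single (atom B v b 1) 1 + Pi.single (atom B v b (-1)) 1 - Pi.single (cst B v) 1)
        - Pi.single (atom B (v + 1) b (-1)) 1 + Pi.single (cst B v) 1 : Ty B → ℤ)
        = Xvec B (v + 1) b - Xvec B v b - ((Pi.single (atom B v b (-1)) 1 - Pi.single (cst B v) 1)
          + (Pi.single (atom B (v + 2) b (-1)) 1 - Pi.single (cst B (v + 2)) 1)) := by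
      unfold Xvec
      rw [show v + 1 + 1 = v + 2 by ring]
      abel
    rw [e, tens_sub_right, tens_sub_right]
    exact Submodule.sub_mem _ (Submodule.sub_mem _ hX' hX) hbr
  · -- `t b = v − 1`: `X_{v+1,b} − bracket`
    rw [if_pos (by decide), if_neg (by decide), show (3 : ZMod 4) = -1 by decide]
    have e : (Pi.single (atom B (v + 1) b 1) (1 : ℤ) + Pi.single (atom B (v + 1) b (-1)) 1 - Pi.single (cst B (v + 1)) 1
        - Pi.single (atom B v b (-1)) 1 - Pi.single (atom B (v + 1) b (-1)) 1 + Pi.single (cst B v) 1 : Ty B → ℤ)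
        = Xvec B (v + 1) b - ((Pi.single (atom B v b (-1)) 1 - Pi.single (cst B v) 1)
          + (Pi.single (atom B (v + 2) b (-1)) 1 - Pi.single (cst B (v + 2)) 1)) := by
      unfold Xvec
      rw [show v + 1 + 1 = v + 2 by ring]
      abel
    rw [e, tens_sub_right]
    exact Submodule.sub_mem _ hX' hbr

omit [AddGroup B] in
/-- **THE SHIFT IDENTITY IN THE SECOND COORDINATE.**  If `N₂` contains the octic pairs, the lifts `e_{cst y} ⊗ X_{u,b}` and the D-moves
`(e_{y′} − e_{y″}) ⊗ (e_a − e_u)`, then for every type `t` and all `y, v`: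
`e_{cst y} ⊗ (raffine (v+1) t − raffine v t) − e_{cst y} ⊗ w_{v+1} ∈ N₂`. [folklore] -/
theorem cst_tens_shift_mem {N₂ : Submodule ℤ (Ty₂ B → ℤ)} (hP : pairs₂ B ≤ N₂)
    (hX1 : ∀ (u : ZMod 4) (b : B) (u' : ZMod 4), tens B (Pi.single (cst B u') 1) (Xvec B u b) ∈ N₂)
    (hD1 : ∀ (u : ZMod 4) (b : B) (k : ZMod 4) (u' u'' : ZMod 4), (k = 1 ∨ k = -1) →
      tens B (Pi.single (cst B u') 1 - Pi.single (cst B u'') 1) (Pi.single (atom B u b k) 1 - Pi.single (cst B u) 1) ∈ N₂)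
    (y v : ZMod 4) (t : Ty B) :
    tens B (Pi.single (cst B y) 1) (raffine B (v + 1) t - raffine B v t) - tens B (Pi.single (cst B y) 1) (Wvec B (v + 1)) ∈ N₂ := by
  rw [← tens_sub_right, raffine_succ_sub_eq_sum, tens_sum_right]
  exact Submodule.sum_mem _ fun b _ => cst_tens_shift_column_mem B hP hX1 hD1 y v t b

end Summit.HodgeConjecture.CorCM.Census.OcticTwist
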